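import Summits.BirchSwinnertonDyer.BirchSwinnertonDyer.Theorems.SignedLowerHalvesSmallImageLowerHalfBothSignsRttCharRoadFrame6
import Summits.BirchSwinnertonDyer.BirchSwinnertonDyer.Theorems.SignedLowerHalvesSmallImageLowerHalfBothSignsRttD2FrameSymm
import Summits.BirchSwinnertonDyer.BirchSwinnertonDyer.Theorems.RamifiedSevenEllipticUnitsQuadraticRamificationAway
import Literature.NumberTheory.Automorphic.GaloisActionPlaces
import HarnessLib

/-!
# Route `SignedLowerHalves`, crux L `SmallImageLowerHalfBothSigns` (stmt-BirchSwinnertonDyer-23599), line `rtt_w3` — THE ROAD-D FRAME, v7 (honda g32):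
# `stub_charRoadFrame_ns_of₇` = `…_of₆` (p829366) with a `c`-STABLE level, exporting `cK • 𝔣 = 𝔣` (= S4‴'s road input `h𝔣c`)

v7 = v6 VERBATIM except: (i) TWO NEW BINDERS right after the ramification premise `hθram` of v6: an automorphism `cK : K ≃ₐ[ℚ] K` and the
`c`-stability of the SUPPORT of the Grössencharakter modulus, `hc𝔪 : ∀ w, 𝔪 ≤ (cK • w).asIdeal → 𝔪 ≤ w.asIdeal` (for the SHARP modulus of producer′
this is `SmallImageLambdaLowerThreeNsThetaPartner.le_smul_asIdeal_iff_of_sharp`, from CM-reality); (ii) the level is SYMMETRISED,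
`𝔣 := cond(χ₀) · (cK • cond(χ₀)) · (𝔪 · (cK • 𝔪)) · (p)`; (iii) ONE NEW EXPORTED CONJUNCT at the very end: `cK • 𝔣 = 𝔣`.
(R) at the new primes: a prime `u ⊇ cK • cond(χ₀)` has `cK • u ⊇ cond(χ₀)`, so `χ₀` — hence `θ′ = χ₀` on the inertia away from `p`, hence `θ` — is ramified at
`cK • u`; by the PIN (`θ` unramified off `p·𝔪`) `𝔪 ⊆ cK • u`, so `𝔪 ⊆ u` (`hc𝔪`) and `hθram` makes `χ₀` ramified at `u`; the primes of `cK • 𝔪` are primes of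
`𝔪` by `hc𝔪` directly (`SmallImageRttD2FrameSymm.forall_le_symmLevel`). (U), `χ₀ = 1` on `Gal(K̄/K(𝔣))`, `cond χ₀ ∣ 𝔣`, `𝔪 ∣ 𝔣`, `(p) ∣ 𝔣` and every
other step are level-monotone and unchanged; `cK • 𝔣 = 𝔣` is `smul_symmLevel` (`cK² = 1` in a quadratic field, `cK • (p) = (p)`).
THEOREMS ONLY (`--supports stmt-BirchSwinnertonDyer-23599`); BSD, crux L / crux M / S4‴ are proved for NO curve by any of this.
[cite: JohnsonLeungKings2011, Thm. 5.2, Cor. 5.3, §4.1–§5.2] [cite: Rubin2000, Ch. VI §6.1–6.2] [cite: NeukirchANT1999, Ch. VI §6 (6.4)–(6.6)] [cite: Washington1997, Prop. 13.2]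
-/

set_option autoImplicit false
-- the Theorems namespace of this sub repeats the summit name by design (D-0017 nested layout)
set_option linter.dupNamespace false

noncomputable section

open scoped Classical MatrixGroups ModularForm BigOperators NumberField Pointwise

namespace Summit.BirchSwinnertonDyer.BirchSwinnertonDyer.Theorems.SmallImageRttCharRoadFrame₇

open CongruenceSubgroup WeierstrassCurve Field Polynomial NumberField IsDedekindDomain Matrix
  Literature.NumberTheory.GaloisRepresentations Literature.NumberTheory.LFunctions
  Literature.NumberTheory.GaloisRepresentations.HeckeCharacter Literature.NumberTheory.Automorphic
  Summit.BirchSwinnertonDyer.BirchSwinnertonDyer.Theorems.HeckeThetaPartner Summit.BirchSwinnertonDyer.Rank1Residual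
  Literature.NumberTheory.EllipticCurves Literature.NumberTheory.EllipticCurves.ModularForms
  Literature.NumberTheory.EllipticCurves.Rank1Residual
  Literature.NumberTheory.EllipticCurves.Kobayashi2003
  Literature.NumberTheory.EllipticCurves.GreenbergVatsal2000 ZpExtension
  Literature.NumberTheory.IwasawaTheory Rat.HeightOneSpectrum
  Summit.BirchSwinnertonDyer.Rank1Residual.Supersingular
  Summit.BirchSwinnertonDyer.Rank1Residual.X1.MuLambda
  Summit.BirchSwinnertonDyer.BirchSwinnertonDyer.Theorems.SmallImageLambdaLowerThreeNsThetaTransport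
  Summit.BirchSwinnertonDyer.BirchSwinnertonDyer.Theorems

set_option maxHeartbeats 1600000 in
/-- ★★★ **The road-D frame WITH SUPPORT CONDITIONS and a `c`-STABLE LEVEL, unconditional** (v7): the 16 conjuncts of `CharRoadFrameProps`, (R), (U), the v5/v6
semantics (`χ₀ = 1` on `Gal(K̄/K(𝔣))`, `(p) ∣ 𝔣`, `𝔪 ∣ 𝔣`) and `cK • 𝔣 = 𝔣`. See the module docstring.
[cite: JohnsonLeungKings2011, Thm. 5.2, Cor. 5.3, §4.1–§5.2] [cite: Rubin2000, Ch. VI §6.1–6.2] [cite: NeukirchANT1999, Ch. VI §6 Cor. (6.6)] -/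
theorem stub_charRoadFrame_ns_of₇ :
    Literature.NumberTheory.ComplexMultiplication.EllipticUnits.JohnsonLeungKings2011.cor53_thm52ShapeO → Literature.NumberTheory.ComplexMultiplication.EllipticUnits.Kato2004.sec155_exists_katoUnitRep → Literature.NumberTheory.ComplexMultiplication.EllipticUnits.DeShalit1987.prop24_i_mem_rayClassField →
      Literature.NumberTheory.ComplexMultiplication.EllipticUnits.DeShalit1987.prop24_ii_galoisAction → Literature.NumberTheory.ComplexMultiplication.EllipticUnits.DeShalit1987.prop25_i_normRelation →
    (∀ (W : WeierstrassCurve ℚ) [W.IsElliptic] [W.IsGloballyMinimal] (p : ℕ) [Fact p.Prime],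
          ∀ (hp : p ≠ 2), ClassX7 W p → ¬ W.HasCM → W.frobeniusTrace p = 0 → ¬ Surj W p →
          ¬ (∃ (A : WeierstrassCurve ℚ) (_ : A.IsElliptic) (_ : A.IsGloballyMinimal),
            A.HasCM ∧ GoodSS A p ∧ A.frobeniusTrace p = 0 ∧
              ∃ e : geomTorsion W (p : ℤ) ≃+ geomTorsion A (p : ℤ),
                ∀ (σ : absoluteGaloisGroup ℚ) (P : geomTorsion W (p : ℤ)), e (σ • P) = σ • e P) →
          ¬ (∃ (A : WeierstrassCurve ℚ) (_ : A.IsElliptic) (_ : A.IsGloballyMinimal) (t : ℚ),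
            A.HasGoodReductionAtPrime p ∧ A.frobeniusTrace p = 0 ∧
              (∃ e : geomTorsion W (p : ℤ) ≃+ geomTorsion A (p : ℤ),
                ∀ (σ : absoluteGaloisGroup ℚ) (P : geomTorsion W (p : ℤ)), e (σ • P) = σ • e P) ∧
              A.entireLFunction 1 / (A.realPeriodRat : ℂ) = ((t : ℚ) : ℂ) ∧ t ≠ 0 ∧ padicValRat p t = 0) →
          ∀ (ε : ℤˣ) (K : Type) [Field K] [NumberField K] (σK : K →+* ℂ) (𝔪 : Ideal (𝓞 K))
            (ψ : HeightOneSpectrum (𝓞 K) → ℂ) (e : PadicAlgCl p ≃+* ℂ),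
            ∀ (hK2 : Module.finrank ℚ K = 2), IsTotallyComplex K → 𝔪 ≠ ⊥ →
            (∀ I : Ideal (𝓞 K), Ideal.absNorm I ≠ p) → ¬ p ∣ (NumberField.discr K).natAbs * Ideal.absNorm 𝔪 →
            (∀ (ℓ : ℕ) [Fact ℓ.Prime], ℓ ∣ (NumberField.discr K).natAbs * Ideal.absNorm 𝔪 → ¬ W.HasGoodReductionAtPrime ℓ) →
            IsGrossencharakter 𝔪 (embType σK) (embTypeConj σK) ψ →
            (∀ n : ℕ, Odd n → n.Coprime ((NumberField.discr K).natAbs * Ideal.absNorm 𝔪) →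
              idealPow K ψ (Ideal.span {(n : 𝓞 K)}) = (jacobiSym (NumberField.discr K) n : ℂ) * (n : ℂ) ^ (2 - 1)) →
            (∀ (ℓ : ℕ) [Fact ℓ.Prime], ℓ ≠ p → W.HasGoodReductionAtPrime ℓ →
              ‖e.symm (∑ᶠ (w : HeightOneSpectrum (𝓞 K)) (_ : Ideal.absNorm w.asIdeal = ℓ), ψ w) -
                (W.frobeniusTrace ℓ : PadicAlgCl p)‖ < 1) →
            (∃ v : HeightOneSpectrum (𝓞 K), v.asIdeal = Ideal.span {(p : 𝓞 K)} ∧ Nat.card (𝓞 K ⧸ v.asIdeal) = p ^ 2) →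
            ∀ (hnd : ¬ (p : ℤ) ∣ NumberField.discr K),
          ∀ (Φ : Multiplicative (AddAut (geomTorsion W p)) ≃* GL (Fin 2) (ZMod p))
            (k : Subalgebra (ZMod p) (Matrix (Fin 2) (Fin 2) (ZMod p))) (e₀ : geomTorsion W p ≃+ (Fin 2 → ZMod p)),
            (∀ (g : Multiplicative (AddAut (geomTorsion W p))) (x : geomTorsion W p),
              e₀ (Multiplicative.toAdd g x) = ((Φ g : GL (Fin 2) (ZMod p)) : Matrix (Fin 2) (Fin 2) (ZMod p)) *ᵥ e₀ x) →
            IsField k → Module.finrank (ZMod p) k = 2 →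
            (letI : Module (ZMod p) (geomTorsion W p) := AddSubgroup.torsionBy.zmodModule
              ∀ g : Multiplicative (AddAut (geomTorsion W p)),
                Matrix.trace ((Φ g : GL (Fin 2) (ZMod p)) : Matrix (Fin 2) (Fin 2) (ZMod p)) =
                  LinearMap.trace (ZMod p) (geomTorsion W p) ((Multiplicative.toAdd g).toAddMonoidHom.toZModLinearMap p)) →
            (galoisRepTorsion W p).range.map Φ.toMonoidHom ≤
              Subgroup.normalizer (Serre1972.unitGroup k : Set (GL (Fin 2) (ZMod p))) →
            ((Serre1972.unitGroup k).comap Φ.toMonoidHom).comap (galoisRepTorsion W p) ≤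
              (absGaloisRestrict ℚ K).toMonoidHom.range →
            (∀ τ : absoluteGaloisGroup K, Φ (galoisRepTorsion W p (absGaloisRestrict ℚ K τ)) ∈ Serre1972.unitGroup k) →
          ∀ (M : ℕ) [NeZero M] (g : CuspForm (Gamma0 M) 2) (ι : coeffField g →+* PadicAlgCl p) (Ω : ℂ),
            ¬ p ∣ M → IsNewform0 g → Literature.NumberTheory.Automorphic.IsCMForm (liftToGamma1 M 2 g) →
            cuspCoeff g p = 0 → IsCohomologicalPlusPeriod g ι Ω →
            (∀ ℓ : ℕ, ℓ.Prime → ¬ ℓ ∣ p * M * W.conductorNorm ℤ →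
              ‖embCoeff g ι ℓ - (W.frobeniusTrace ℓ : PadicAlgCl p)‖ < 1) →
            (∀ ℓ : ℕ, ℓ.Prime → ¬ ℓ ∣ (NumberField.discr K).natAbs * Ideal.absNorm 𝔪 →
              embCoeff g ι ℓ = e.symm (∑ᶠ (w : HeightOneSpectrum (𝓞 K)) (_ : Ideal.absNorm w.asIdeal = ℓ), ψ w)) →
            ∀ (κ : ZpExtension ℚ p) (γ : absoluteGaloisGroup ℚ),
              ∀ (hκ : κ.IsCyclotomic), κ.IsTopGenerator γ → IsCyclotomicVariable p γ →
            ∀ (S₀ : Finset (HeightOneSpectrum (𝓞 ℚ))), (∀ v ∈ S₀, ((p : ℕ) : 𝓞 ℚ) ∉ v.asIdeal) →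
              (∀ v : HeightOneSpectrum (𝓞 ℚ), ¬ W.HasGoodReductionAt v → v ∈ S₀) →
              (∀ v : HeightOneSpectrum (𝓞 ℚ), natGenerator v ∣ M → v ∈ S₀) →
            ∀ (S : Set (PadicAlgCl p)) (θ : FramedGaloisRep K (padicCoeffIntegers S) 1) (γK : absoluteGaloisGroup K)
              (j : (W.baseChange K).geomPrimaryTorsion p →+ (GreenbergSelmer.Cofree θ (padicCoeffField S))),
              ∀ (hS : 0 < Module.finrank ℚ_[p] (padicCoeffField S)),
              (∀ w : HeightOneSpectrum (𝓞 K), (p : 𝓞 K) ∉ w.asIdeal → ¬ 𝔪 ≤ w.asIdeal →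
                θ.IsUnramifiedAt w ∧ ∃ P : Polynomial (padicCoeffIntegers S),
                  P.map (padicCoeffIntegers S).subtype = X - C (e.symm (ψ w)) ∧ θ.HasFrobCharpolyAt w P) →
              -- (v6, ROAD-𝔪) `θ` is RAMIFIED at every prime of `𝔪` away from `p` (sharp support of the Grössencharakter modulus)
              (∀ w : HeightOneSpectrum (𝓞 K), 𝔪 ≤ w.asIdeal → ((p : ℕ) : 𝓞 K) ∉ w.asIdeal →
                ∃ 𝔓 ∈ w.primesAbove, ∃ τ ∈ 𝔓.inertia (absoluteGaloisGroup K),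
                  ((θ τ : GL (Fin 1) (padicCoeffIntegers S)) : Matrix (Fin 1) (Fin 1) (padicCoeffIntegers S)) 0 0 ≠ 1) →
              -- (v7, ROAD-𝔪 `h𝔣c`) an automorphism `cK` of `K` under which the SUPPORT of `𝔪` is stable
              ∀ (cK : K ≃ₐ[ℚ] K), (∀ w : HeightOneSpectrum (𝓞 K), 𝔪 ≤ (cK • w).asIdeal → 𝔪 ≤ w.asIdeal) →
              ∀ (hγK : (κ.restrictOfFinrankEqTwo hp K hK2).IsTopGenerator γK),
              (∀ v : HeightOneSpectrum (𝓞 K), (p : 𝓞 K) ∈ v.asIdeal →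
                ∀ (δ : absoluteGaloisGroup (v.adicCompletion K)) (t : (W.baseChange K).geomPrimaryTorsion p),
                  j (resGalOfEmb (closureEmb (K := K) (v.adicCompletion K)) δ • t) =
                    resGalOfEmb (closureEmb (K := K) (v.adicCompletion K)) δ • j t) →
              Submodule.span (padicCoeffIntegers S) (Set.range j) = ⊤ →
            ∀ (Dψ : SmallImageCharSignedSelmer.SignedTransportDualDataSat (κ.restrictOfFinrankEqTwo hp K hK2) γK
                (GreenbergSelmer.Cofree θ (padicCoeffField S)) (padicCoeffIntegers S) (W.baseChange K) j
                {w : HeightOneSpectrum (𝓞 K) | ∃ v ∈ S₀, ((natGenerator v : ℕ) : 𝓞 K) ∈ w.asIdeal} ε),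
              Module.Finite (IwasawaAlgebra p) Dψ.X → Module.IsTorsion (IwasawaAlgebra p) Dψ.X →
            ∀ L : IwasawaAlgebraO (Set.range ι), L ≠ 0 →
              (∀ n : ℕ, (Even n ↔ ε = 1) → IsCongrModOmegaO (Set.range ι) n ((mazurTateElementK g Ω p n).map ι)
                (((((-1) ^ (n / 2 + 1) * (if ε = 1 then cyclotomicOmegaMinus p n else cyclotomicOmegaPlus p n)).map
                    (Int.castRingHom (PadicAlgCl p)) : (PadicAlgCl p)[X]) : PowerSeries (PadicAlgCl p)) *
                  iwasawaOToPowerSeries (Set.range ι) L)) →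
              ∀ (vp : HeightOneSpectrum (𝓞 K)) (hv : vp.asIdeal = Ideal.span {((p : ℕ) : 𝓞 K)}),
                ∃ (κ₂ : ZpExtension K p) (γ₂ : absoluteGaloisGroup K) (𝔣 : Ideal (𝓞 K))
                    (χ₀ θ' : absoluteGaloisGroup K →ₜ* (↥(padicCoeffIntegers S))ˣ)
                    (D₀ : Literature.NumberTheory.ComplexMultiplication.EllipticUnits.JohnsonLeungKings2011.TwistedIwasawaDataO S (κ.restrictOfFinrankEqTwo hp K hK2) κ₂ γK⁻¹ γ₂ χ₀ 𝔣 σK)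
                    (D₀' : Literature.NumberTheory.ComplexMultiplication.EllipticUnits.JohnsonLeungKings2011.IwasawaCohomologyDataO S (κ.restrictOfFinrankEqTwo hp K hK2) κ₂ γK⁻¹ γ₂ θ' 𝔣 0)
                    (D₁' : Literature.NumberTheory.ComplexMultiplication.EllipticUnits.JohnsonLeungKings2011.IwasawaCohomologyDataO S (κ.restrictOfFinrankEqTwo hp K hK2) κ₂ γK⁻¹ γ₂ θ' 𝔣 1)
                    (D₂' : Literature.NumberTheory.ComplexMultiplication.EllipticUnits.JohnsonLeungKings2011.IwasawaCohomologyDataO S (κ.restrictOfFinrankEqTwo hp K hK2) κ₂ γK⁻¹ γ₂ θ' 𝔣 2)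
                    (hθfin : ∃ m : ℕ, 0 < m ∧ ∀ τ : absoluteGaloisGroup K, χ₀ τ ^ m = 1)
                    (hker : ∀ τ ∈ ZpExtension.pairKer (κ.restrictOfFinrankEqTwo hp K hK2) κ₂, θ' τ = χ₀ τ)
                    (hN : ∀ k : ℕ, ∀ τ ∈ ramificationSubgroup K (Literature.NumberTheory.ComplexMultiplication.EllipticUnits.JohnsonLeungKings2011.suppPF p 𝔣), ∃ b : ↥(padicCoeffIntegers S),
                      ((θ' τ : (↥(padicCoeffIntegers S))ˣ) : ↥(padicCoeffIntegers S)) = (χ₀ τ : (↥(padicCoeffIntegers S))ˣ) + ((p : ↥(padicCoeffIntegers S))) ^ k * b)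
                    (σ : Literature.NumberTheory.ComplexMultiplication.EllipticUnits.IwasawaAlgebraO₂ S ≃+* Literature.NumberTheory.ComplexMultiplication.EllipticUnits.IwasawaAlgebraO₂ S)
                    (Dθ : Literature.NumberTheory.ComplexMultiplication.EllipticUnits.JohnsonLeungKings2011.ZetaSkeleton (Literature.NumberTheory.ComplexMultiplication.EllipticUnits.IwasawaAlgebraO₂ S) (Literature.NumberTheory.ComplexMultiplication.EllipticUnits.JohnsonLeungKings2011.AuxIdeals p 𝔣) D₀'.H D₁'.H D₂'.H) (a : Literature.NumberTheory.ComplexMultiplication.EllipticUnits.JohnsonLeungKings2011.AuxIdeals p 𝔣),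
                  (γ₂ ∈ ((κ.restrictOfFinrankEqTwo hp K hK2)).kerSubgroup ∧
                    (∃ u₁ u₂ : ℤ_[p]ˣ, ZpExtension.IsTopGeneratorPair (((κ.restrictOfFinrankEqTwo hp K hK2)).unitTwist u₁) (κ₂.unitTwist u₂) γK⁻¹ γ₂) ∧
                    (∀ g : absoluteGaloisGroup K, ((θ' g : (↥(padicCoeffIntegers S))ˣ) : ↥(padicCoeffIntegers S)) *
                      ((θ g : GL (Fin 1) ↥(padicCoeffIntegers S)) : Matrix (Fin 1) (Fin 1) ↥(padicCoeffIntegers S)) 0 0 = 1) ∧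
                    Module.Finite (Literature.NumberTheory.ComplexMultiplication.EllipticUnits.IwasawaAlgebraO₂ S) D₀.D1.H ∧ Module.Finite (Literature.NumberTheory.ComplexMultiplication.EllipticUnits.IwasawaAlgebraO₂ S) D₀.D2.H ∧
                    (D₀.toZetaSkeleton (D₀.nsub_regular hθfin)).Thm52Shape ∧
                    (∀ (r : Literature.NumberTheory.ComplexMultiplication.EllipticUnits.IwasawaAlgebraO₂ S) (x : D₀.D1.H), Summit.BirchSwinnertonDyer.BirchSwinnertonDyer.Theorems.SmallImageRttD2Twist.twistEquivOfKer S (κ.restrictOfFinrankEqTwo hp K hK2) κ₂ χ₀ θ' 𝔣 hker hN D₀.D1 D₁' (r • x) = σ r • Summit.BirchSwinnertonDyer.BirchSwinnertonDyer.Theorems.SmallImageRttD2Twist.twistEquivOfKer S (κ.restrictOfFinrankEqTwo hp K hK2) κ₂ χ₀ θ' 𝔣 hker hN D₀.D1 D₁' x) ∧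
                    (∀ a' : Literature.NumberTheory.ComplexMultiplication.EllipticUnits.JohnsonLeungKings2011.AuxIdeals p 𝔣, Summit.BirchSwinnertonDyer.BirchSwinnertonDyer.Theorems.SmallImageRttD2Twist.twistEquivOfKer S (κ.restrictOfFinrankEqTwo hp K hK2) κ₂ χ₀ θ' 𝔣 hker hN D₀.D1 D₁' ((D₀.toZetaSkeleton (D₀.nsub_regular hθfin)).aZeta a') = Dθ.aZeta a') ∧
                    (∀ (r : Literature.NumberTheory.ComplexMultiplication.EllipticUnits.IwasawaAlgebraO₂ S) (x : D₀.D2.H), Summit.BirchSwinnertonDyer.BirchSwinnertonDyer.Theorems.SmallImageRttD2Twist.twistEquivOfKer S (κ.restrictOfFinrankEqTwo hp K hK2) κ₂ χ₀ θ' 𝔣 hker hN D₀.D2 D₂' (r • x) = σ r • Summit.BirchSwinnertonDyer.BirchSwinnertonDyer.Theorems.SmallImageRttD2Twist.twistEquivOfKer S (κ.restrictOfFinrankEqTwo hp K hK2) κ₂ χ₀ θ' 𝔣 hker hN D₀.D2 D₂' x) ∧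
                    (∀ (r : Literature.NumberTheory.ComplexMultiplication.EllipticUnits.IwasawaAlgebraO₂ S) (x : D₀.D0.H), Summit.BirchSwinnertonDyer.BirchSwinnertonDyer.Theorems.SmallImageRttD2Twist.twistEquivOfKer S (κ.restrictOfFinrankEqTwo hp K hK2) κ₂ χ₀ θ' 𝔣 hker hN D₀.D0 D₀' (r • x) = σ r • Summit.BirchSwinnertonDyer.BirchSwinnertonDyer.Theorems.SmallImageRttD2Twist.twistEquivOfKer S (κ.restrictOfFinrankEqTwo hp K hK2) κ₂ χ₀ θ' 𝔣 hker hN D₀.D0 D₀' x) ∧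
                    (∀ a' : Literature.NumberTheory.ComplexMultiplication.EllipticUnits.JohnsonLeungKings2011.AuxIdeals p 𝔣, Dθ.nsub a' = σ ((D₀.toZetaSkeleton (D₀.nsub_regular hθfin)).nsub a')) ∧
                    σ PowerSeries.X = (PowerSeries.C (PowerSeries.C (((χ₀ γK⁻¹ * (θ' γK⁻¹)⁻¹ : (↥(padicCoeffIntegers S))ˣ)) : ↥(padicCoeffIntegers S)) : PowerSeries ↥(padicCoeffIntegers S)) : Literature.NumberTheory.ComplexMultiplication.EllipticUnits.IwasawaAlgebraO₂ S) * (1 + PowerSeries.X) - 1 ∧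
                    σ (PowerSeries.C (PowerSeries.X : PowerSeries ↥(padicCoeffIntegers S))) =
                      (PowerSeries.C (PowerSeries.C (((χ₀ γ₂ * (θ' γ₂)⁻¹ : (↥(padicCoeffIntegers S))ˣ)) : ↥(padicCoeffIntegers S)) : PowerSeries ↥(padicCoeffIntegers S)) : Literature.NumberTheory.ComplexMultiplication.EllipticUnits.IwasawaAlgebraO₂ S) *
                        (1 + (PowerSeries.C (PowerSeries.X : PowerSeries ↥(padicCoeffIntegers S)) : Literature.NumberTheory.ComplexMultiplication.EllipticUnits.IwasawaAlgebraO₂ S)) - 1 ∧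
                    (∀ c : ↥(padicCoeffIntegers S), σ (PowerSeries.C (PowerSeries.C c : PowerSeries ↥(padicCoeffIntegers S))) = PowerSeries.C (PowerSeries.C c : PowerSeries ↥(padicCoeffIntegers S))) ∧
                    Submodule.torsionBy (Literature.NumberTheory.ComplexMultiplication.EllipticUnits.IwasawaAlgebraO₂ S) D₁'.H (PowerSeries.C (PowerSeries.X - PowerSeries.C (0 : ↥(padicCoeffIntegers S)) : PowerSeries ↥(padicCoeffIntegers S)) : Literature.NumberTheory.ComplexMultiplication.EllipticUnits.IwasawaAlgebraO₂ S) = ⊥ ∧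
                    IsUnit (Summit.BirchSwinnertonDyer.BirchSwinnertonDyer.Theorems.SmallImageRttD2J2.phi0 S (Dθ.nsub a))) ∧
                  ((∀ w ∈ Literature.NumberTheory.ComplexMultiplication.EllipticUnits.JohnsonLeungKings2011.suppPF p 𝔣, ((p : ℕ) : 𝓞 K) ∉ w.asIdeal →
                      ∃ 𝔓 ∈ w.primesAbove, ∃ τ ∈ 𝔓.inertia (absoluteGaloisGroup K), θ' τ ≠ 1) ∧
                    (∀ w : HeightOneSpectrum (𝓞 K), w ∉ Literature.NumberTheory.ComplexMultiplication.EllipticUnits.JohnsonLeungKings2011.suppPF p 𝔣 →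
                      ∀ 𝔓 ∈ w.primesAbove, ∀ τ ∈ 𝔓.inertia (absoluteGaloisGroup K), θ' τ = 1)) ∧
                  -- (v5) `χ₀` factors through `Gal(K(𝔣)/K)`, `p ∣ 𝔣`; (v6) `𝔪 ∣ 𝔣`; (v7) `cK • 𝔣 = 𝔣`
                  ((∀ τ ∈ absGaloisFixingSubgroup (Literature.NumberTheory.NumberFields.rayClassField K 𝔣), χ₀ τ = 1) ∧
                    Ideal.span {((p : ℕ) : 𝓞 K)} ∣ 𝔣 ∧ 𝔪 ∣ 𝔣 ∧ cK • 𝔣 = 𝔣)) := by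
  intro h53 hKE h24i h24ii h25 W _ _ p _ hp hX7 hncm hap hns hT1 hT1u ε K _ _ σK 𝔪 ψ e hK2 htc h𝔪 hnormI hcop hbad hψ hψpow hcongrW hinert hnd Φ k e₀ hΦ hkf hk2 htr hnorm hUK hUθ M _ g ι Ω hpM hng hcm hapg hΩ hcoeffW hcoeffψ κ γ hκ hγ hcv S₀ hS₀p hS₀bad hS₀M S θ γK j hS hθ hθram cK hc𝔪 hγK hj hjspan Dψ hfin htor L hL hcongr vp hv
  haveI : FiniteDimensional ℚ_[p] (padicCoeffField S) := Module.finite_of_finrank_pos hS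
  haveI : IsDiscreteValuationRing ↥(padicCoeffIntegers S) := by
    rw [padicCoeffIntegers_eq_unitBall S]; exact LambdaLowerBoundO.isDiscreteValuationRing_unitBall p _
  haveI : NumberField.IsTotallyComplex K := htc
  have hK : IsImaginaryQuadratic K := ⟨hK2, htc⟩
  have himag : ∀ w : NumberField.InfinitePlace K, w.IsComplex := fun w ↦ NumberField.IsTotallyComplex.isComplex w
  set θ' : absoluteGaloisGroup K →ₜ* (↥(padicCoeffIntegers S))ˣ := (FramedRep.det θ)⁻¹ with hθ'def
  have hθ'apply : ∀ g₁ : absoluteGaloisGroup K, θ' g₁ = (FramedRep.det θ g₁)⁻¹ := fun _ ↦ rfl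
  have hθ'θ : ∀ g₁ : absoluteGaloisGroup K, ((θ' g₁ : (↥(padicCoeffIntegers S))ˣ) : ↥(padicCoeffIntegers S)) *
      ((θ g₁ : GL (Fin 1) ↥(padicCoeffIntegers S)) : Matrix (Fin 1) (Fin 1) ↥(padicCoeffIntegers S)) 0 0 = 1 := fun g₁ ↦ by
    have h1 : ((θ' g₁ : (↥(padicCoeffIntegers S))ˣ) : ↥(padicCoeffIntegers S)) * ((FramedRep.det θ g₁ : (↥(padicCoeffIntegers S))ˣ) : ↥(padicCoeffIntegers S)) = 1 := by
      rw [hθ'apply, ← Units.val_mul, inv_mul_cancel, Units.val_one]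
    have hdet : ((FramedRep.det θ g₁ : (↥(padicCoeffIntegers S))ˣ) : ↥(padicCoeffIntegers S)) =
        ((θ g₁ : GL (Fin 1) ↥(padicCoeffIntegers S)) : Matrix (Fin 1) (Fin 1) ↥(padicCoeffIntegers S)) 0 0 := by
      rw [FramedRep.det_apply, Matrix.GeneralLinearGroup.val_det_apply, Matrix.det_fin_one]
    rw [← hdet]
    exact h1
  obtain ⟨κ₂, γ₂, u₁, u₂, hγ₂ker, hpair⟩ :=
    SmallImageRttD2Twist.exists_isTopGeneratorPair_inv_left hK2 himag (κ.restrictOfFinrankEqTwo hp K hK2) hγK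
  obtain ⟨χ₀, ηc, M, hM0, hχη, hχM, hχnear, hηker, hkerχ, -, -, -⟩ :=
    SmallImageRttD2FrameFinite.exists_torsionCharacter S hK2.le ((κ.restrictOfFinrankEqTwo hp K hK2).unitTwist u₁) (κ₂.unitTwist u₂) hpair θ'
  have hker : ∀ τ ∈ ZpExtension.pairKer (κ.restrictOfFinrankEqTwo hp K hK2) κ₂, θ' τ = χ₀ τ := fun τ hτ ↦ by
    refine hkerχ τ ?_
    simp only [ZpExtension.pairKer, ZpExtension.kerSubgroup_unitTwist] at hτ ⊢
    exact hτ
  have hθfin : ∃ m : ℕ, 0 < m ∧ ∀ τ : absoluteGaloisGroup K, χ₀ τ ^ m = 1 := ⟨M, hM0, hχM⟩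
  obtain ⟨𝔣₀, h𝔣₀, hχ𝔣₀, hram₀, hunr₀⟩ := SmallImageRttD2FrameSupport.exists_conductor_of_pow_eq_one S χ₀ hM0 hχM
  have hcc : cK * cK = 1 := RamifiedSevenEllipticUnits.QuadraticRamification.algEquiv_mul_self_eq_one_of_finrank_eq_two hK2 cK
  have hfix : ∀ w : HeightOneSpectrum (𝓞 K), ((p : ℕ) : 𝓞 K) ∈ w.asIdeal → cK • w = w :=
    fun w hw ↦ SmallImageRttD2FrameSymm.smul_eq_self_of_natCast_mem cK hv hw
  set 𝔣 : Ideal (𝓞 K) := 𝔣₀ * (cK • 𝔣₀) * (𝔪 * (cK • 𝔪)) * Ideal.span {((p : ℕ) : 𝓞 K)} ^ 1 with h𝔣def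
  have hpK : ((p : ℕ) : 𝓞 K) ≠ 0 := by exact_mod_cast (Fact.out : p.Prime).ne_zero
  have hcne : ∀ I : Ideal (𝓞 K), I ≠ ⊥ → cK • I ≠ ⊥ := fun I hI h ↦
    hI (by rw [← SmallImageRttD2FrameSymm.smul_smul_eq hcc I, h, Ideal.smul_bot])
  have h𝔣 : 𝔣 ≠ ⊥ :=
    mul_ne_zero (mul_ne_zero (mul_ne_zero h𝔣₀ (hcne _ h𝔣₀)) (mul_ne_zero h𝔪 (hcne _ h𝔪)))
      (pow_ne_zero _ (by rw [Ne, Ideal.zero_eq_bot, Ideal.span_singleton_eq_bot]; exact hpK))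
  obtain ⟨h𝔣₀𝔣, h𝔪𝔣, -⟩ := SmallImageRttD2FrameSymm.dvd_symmLevel 𝔣₀ 𝔪 (Ideal.span {((p : ℕ) : 𝓞 K)}) cK
  have hJle : 𝔣₀ * (cK • 𝔣₀) * (𝔪 * (cK • 𝔪)) ≤ 𝔣₀ := Ideal.mul_le_right.trans Ideal.mul_le_right
  have hθ𝔣 : ∀ τ ∈ absGaloisFixingSubgroup (Literature.NumberTheory.NumberFields.rayClassField K 𝔣), χ₀ τ = 1 := fun τ hτ ↦
    hχ𝔣₀ τ (SmallImageRttD2FrameConductor.absGaloisFixingSubgroup_rayClassField_mono h𝔣 (Ideal.mul_le_right.trans hJle) hτ)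
  have hkerχ' : ∀ g : absoluteGaloisGroup K, ((κ.restrictOfFinrankEqTwo hp K hK2).unitTwist u₁) g = 1 → (κ₂.unitTwist u₂) g = 1 → θ' g = χ₀ g :=
    fun g h1 h2 ↦ hkerχ g (ZpExtension.mem_pairKer_iff.mpr ⟨h1, h2⟩)
  have hp𝔪 : ∀ w : HeightOneSpectrum (𝓞 K), 𝔪 ≤ w.asIdeal → ((p : ℕ) : 𝓞 K) ∉ w.asIdeal :=
    fun w hw ↦ SmallImageRttD2FrameSymm.not_natCast_mem_of_le (Fact.out : p.Prime) hcop hw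
  have hχ₀θ : ∀ w : HeightOneSpectrum (𝓞 K), ((p : ℕ) : 𝓞 K) ∉ w.asIdeal →
      (∃ 𝔓 ∈ w.primesAbove, ∃ τ ∈ 𝔓.inertia (absoluteGaloisGroup K),
        ((θ τ : GL (Fin 1) (padicCoeffIntegers S)) : Matrix (Fin 1) (Fin 1) (padicCoeffIntegers S)) 0 0 ≠ 1) →
      ∃ 𝔓 ∈ w.primesAbove, ∃ τ ∈ 𝔓.inertia (absoluteGaloisGroup K), χ₀ τ ≠ 1 := by
    intro w hpw ⟨𝔓, h𝔓, τ, hτ, hne⟩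
    refine ⟨𝔓, h𝔓, τ, hτ, fun hχ ↦ hne ?_⟩
    have hθ'τ : θ' τ = 1 := by
      rw [hkerχ' τ
        (by rw [← ZpExtension.mem_kerSubgroup, ZpExtension.kerSubgroup_unitTwist]; exact ZpExtension.inertia_le_kerSubgroup_holds K p _ hpw h𝔓 hτ)
        (by rw [← ZpExtension.mem_kerSubgroup, ZpExtension.kerSubgroup_unitTwist]; exact ZpExtension.inertia_le_kerSubgroup_holds K p _ hpw h𝔓 hτ)]
      exact hχ
    have h := hθ'θ τ
    rwa [hθ'τ, Units.val_one, one_mul] at h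
  have hram𝔪 : ∀ w : HeightOneSpectrum (𝓞 K), 𝔪 ≤ w.asIdeal →
      ∃ 𝔓 ∈ w.primesAbove, ∃ τ ∈ 𝔓.inertia (absoluteGaloisGroup K), χ₀ τ ≠ 1 :=
    fun w hw ↦ hχ₀θ w (hp𝔪 w hw) (hθram w hw (hp𝔪 w hw))
  have hsymm : ∀ w : HeightOneSpectrum (𝓞 K), ((p : ℕ) : 𝓞 K) ∉ w.asIdeal →
      (∃ 𝔓 ∈ (cK • w).primesAbove, ∃ τ ∈ 𝔓.inertia (absoluteGaloisGroup K), χ₀ τ ≠ 1) →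
      ∃ 𝔓 ∈ w.primesAbove, ∃ τ ∈ 𝔓.inertia (absoluteGaloisGroup K), χ₀ τ ≠ 1 := by
    intro w hpw ⟨𝔓, h𝔓, τ, hτ, hne⟩
    have hpcw : ((p : ℕ) : 𝓞 K) ∉ (cK • w).asIdeal := fun h ↦ by
      have e : cK • (cK • w) = cK • w := hfix (cK • w) h
      rw [SmallImageRttD2FrameSymm.smul_smul_eq' hcc] at e
      rw [← e] at h
      exact hpw h
    have hθ'τ : θ' τ = χ₀ τ := hkerχ' τ
      (by rw [← ZpExtension.mem_kerSubgroup, ZpExtension.kerSubgroup_unitTwist]; exact ZpExtension.inertia_le_kerSubgroup_holds K p _ hpcw h𝔓 hτ)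
      (by rw [← ZpExtension.mem_kerSubgroup, ZpExtension.kerSubgroup_unitTwist]; exact ZpExtension.inertia_le_kerSubgroup_holds K p _ hpcw h𝔓 hτ)
    have hθτ : ((θ τ : GL (Fin 1) (padicCoeffIntegers S)) : Matrix (Fin 1) (Fin 1) (padicCoeffIntegers S)) 0 0 ≠ 1 := by
      intro h1
      apply hne
      have h := hθ'θ τ
      rw [h1, mul_one, ← Units.val_one] at h
      rw [← hθ'τ]
      exact Units.ext h
    have h𝔪cw : 𝔪 ≤ (cK • w).asIdeal := by
      by_contra hnot
      apply hθτ
      rw [(hθ (cK • w) hpcw hnot).1 𝔓 h𝔓 τ hτ, Units.val_one, Matrix.one_apply_eq]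
    exact hram𝔪 w (hc𝔪 w h𝔪cw)
  have hram' := SmallImageRttD2FrameSymm.forall_le_symmLevel
    (R := fun w : HeightOneSpectrum (𝓞 K) ↦ ∃ 𝔓 ∈ w.primesAbove, ∃ τ ∈ 𝔓.inertia (absoluteGaloisGroup K), χ₀ τ ≠ 1)
    hcc hfix hram₀ hram𝔪 hsymm hc𝔪
  have hunr' : ∀ w : HeightOneSpectrum (𝓞 K), ¬ 𝔣₀ * (cK • 𝔣₀) * (𝔪 * (cK • 𝔪)) ≤ w.asIdeal →
      ∀ 𝔓 ∈ w.primesAbove, ∀ τ ∈ 𝔓.inertia (absoluteGaloisGroup K), χ₀ τ = 1 :=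
    fun w hw ↦ hunr₀ w fun h0 ↦ hw (hJle.trans h0)
  have hR := SmallImageRttD2FrameSupport.frameSupp_ramified S ((κ.restrictOfFinrankEqTwo hp K hK2).unitTwist u₁) (κ₂.unitTwist u₂) χ₀ θ' hkerχ' hram' 1
  have hU := SmallImageRttD2FrameSupport.frameSupp_unramified S ((κ.restrictOfFinrankEqTwo hp K hK2).unitTwist u₁) (κ₂.unitTwist u₂) χ₀ θ' hkerχ' hunr' 1
  have hθ'N : ∀ τ ∈ ramificationSubgroup K (Literature.NumberTheory.ComplexMultiplication.EllipticUnits.JohnsonLeungKings2011.suppPF p 𝔣), θ' τ = 1 :=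
    fun τ hτ ↦ SmallImageRttD2Twist.eq_one_of_mem_ramificationSubgroup _ θ' hU hτ
  have hηN : ∀ τ ∈ ramificationSubgroup K (Literature.NumberTheory.ComplexMultiplication.EllipticUnits.JohnsonLeungKings2011.suppPF p 𝔣), ηc τ = 1 :=
    fun τ hτ ↦ SmallImageRttD2Twist.eq_one_of_mem_ramificationSubgroup _ ηc (fun v hv' 𝔓 h𝔓 σ hσ ↦ by
      obtain ⟨hpv, -⟩ := SmallImageRttD2Twist.not_mem_and_not_le_of_not_mem_suppPF (p := p) h𝔣₀𝔣 hv'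
      have h1 : σ ∈ ((κ.restrictOfFinrankEqTwo hp K hK2).unitTwist u₁).kerSubgroup := by
        rw [ZpExtension.kerSubgroup_unitTwist]; exact ZpExtension.inertia_le_kerSubgroup_holds K p _ hpv h𝔓 hσ
      have h2 : σ ∈ (κ₂.unitTwist u₂).kerSubgroup := by
        rw [ZpExtension.kerSubgroup_unitTwist]; exact ZpExtension.inertia_le_kerSubgroup_holds K p _ hpv h𝔓 hσ
      exact hηker σ (ZpExtension.mem_kerSubgroup.mp h1) (ZpExtension.mem_kerSubgroup.mp h2)) hτ
  have hχ₀N : ∀ τ ∈ ramificationSubgroup K (Literature.NumberTheory.ComplexMultiplication.EllipticUnits.JohnsonLeungKings2011.suppPF p 𝔣), χ₀ τ = 1 :=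
    fun τ hτ ↦ by have h := hχη τ; rw [hηN τ hτ, mul_one, hθ'N τ hτ] at h; exact h
  have hN := fun kk ↦ SmallImageRttD2Twist.hN_of_trivial S χ₀ θ' hχ₀N hθ'N kk
  obtain ⟨I0⟩ : Nonempty (Literature.NumberTheory.ComplexMultiplication.EllipticUnits.JohnsonLeungKings2011.IwasawaCohomologyDataO S
      (κ.restrictOfFinrankEqTwo hp K hK2) κ₂ γK⁻¹ γ₂ χ₀ 𝔣 0) :=
    Literature.NumberTheory.ComplexMultiplication.EllipticUnits.JohnsonLeungKings2011.nonempty_iwasawaCohomologyDataO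
      (S := S) (κ₁ := κ.restrictOfFinrankEqTwo hp K hK2) (κ₂ := κ₂) (γ₁ := γK⁻¹) (γ₂ := γ₂) (θ := χ₀) (𝔣 := 𝔣) (i := 0) (by norm_num)
  obtain ⟨I1⟩ : Nonempty (Literature.NumberTheory.ComplexMultiplication.EllipticUnits.JohnsonLeungKings2011.IwasawaCohomologyDataO S
      (κ.restrictOfFinrankEqTwo hp K hK2) κ₂ γK⁻¹ γ₂ χ₀ 𝔣 1) :=
    Literature.NumberTheory.ComplexMultiplication.EllipticUnits.JohnsonLeungKings2011.nonempty_iwasawaCohomologyDataO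
      (S := S) (κ₁ := κ.restrictOfFinrankEqTwo hp K hK2) (κ₂ := κ₂) (γ₁ := γK⁻¹) (γ₂ := γ₂) (θ := χ₀) (𝔣 := 𝔣) (i := 1) (by norm_num)
  obtain ⟨I2⟩ : Nonempty (Literature.NumberTheory.ComplexMultiplication.EllipticUnits.JohnsonLeungKings2011.IwasawaCohomologyDataO S
      (κ.restrictOfFinrankEqTwo hp K hK2) κ₂ γK⁻¹ γ₂ χ₀ 𝔣 2) :=
    Literature.NumberTheory.ComplexMultiplication.EllipticUnits.JohnsonLeungKings2011.nonempty_iwasawaCohomologyDataO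
      (S := S) (κ₁ := κ.restrictOfFinrankEqTwo hp K hK2) (κ₂ := κ₂) (γ₁ := γK⁻¹) (γ₂ := γ₂) (θ := χ₀) (𝔣 := 𝔣) (i := 2) (by norm_num)
  obtain ⟨D₀'⟩ : Nonempty (Literature.NumberTheory.ComplexMultiplication.EllipticUnits.JohnsonLeungKings2011.IwasawaCohomologyDataO S
      (κ.restrictOfFinrankEqTwo hp K hK2) κ₂ γK⁻¹ γ₂ θ' 𝔣 0) :=
    Literature.NumberTheory.ComplexMultiplication.EllipticUnits.JohnsonLeungKings2011.nonempty_iwasawaCohomologyDataO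
      (S := S) (κ₁ := κ.restrictOfFinrankEqTwo hp K hK2) (κ₂ := κ₂) (γ₁ := γK⁻¹) (γ₂ := γ₂) (θ := θ') (𝔣 := 𝔣) (i := 0) (by norm_num)
  obtain ⟨D₁'⟩ : Nonempty (Literature.NumberTheory.ComplexMultiplication.EllipticUnits.JohnsonLeungKings2011.IwasawaCohomologyDataO S
      (κ.restrictOfFinrankEqTwo hp K hK2) κ₂ γK⁻¹ γ₂ θ' 𝔣 1) :=
    Literature.NumberTheory.ComplexMultiplication.EllipticUnits.JohnsonLeungKings2011.nonempty_iwasawaCohomologyDataO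
      (S := S) (κ₁ := κ.restrictOfFinrankEqTwo hp K hK2) (κ₂ := κ₂) (γ₁ := γK⁻¹) (γ₂ := γ₂) (θ := θ') (𝔣 := 𝔣) (i := 1) (by norm_num)
  obtain ⟨D₂'⟩ : Nonempty (Literature.NumberTheory.ComplexMultiplication.EllipticUnits.JohnsonLeungKings2011.IwasawaCohomologyDataO S
      (κ.restrictOfFinrankEqTwo hp K hK2) κ₂ γK⁻¹ γ₂ θ' 𝔣 2) :=
    Literature.NumberTheory.ComplexMultiplication.EllipticUnits.JohnsonLeungKings2011.nonempty_iwasawaCohomologyDataO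
      (S := S) (κ₁ := κ.restrictOfFinrankEqTwo hp K hK2) (κ₂ := κ₂) (γ₁ := γK⁻¹) (γ₂ := γ₂) (θ := θ') (𝔣 := 𝔣) (i := 2) (by norm_num)
  obtain ⟨D₀, -, -, -, hfin1, hfin2, h52⟩ := SmallImageRttD2OUnits.exists_twistedIwasawaDataO_thm52Shape (p := p) (S := S)
    (κ₁ := κ.restrictOfFinrankEqTwo hp K hK2) (κ₂ := κ₂) (γ₁ := γK⁻¹) (γ₂ := γ₂) (θ := χ₀) (𝔣 := 𝔣)
    h53 hKE h24i h24ii h25 hK σK ⟨u₁, u₂, hpair⟩ h𝔣 hθ𝔣 I0 I1 I2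
  obtain ⟨σ, Dθ, he₁, haZ, he₂, he₀, hnsub, -, hσX, hσCX, hσC⟩ :=
    SmallImageRttD2Twist.exists_twistSkeleton_ofKer S (κ.restrictOfFinrankEqTwo hp K hK2) κ₂ χ₀ θ' 𝔣 hN D₀.D0 D₀.D1 D₀.D2 D₀' D₁' D₂'
      (D₀.toZetaSkeleton (D₀.nsub_regular hθfin)) hker
  have hgθ' := SmallImageRttD2AuxIdeal.exists_isUnit_cyclotomicCharacter_mul_inv_sub_one (S := S) hK2 hp hnd h𝔪 hinert ψ e hψpow θ hθ θ' hθ'θ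
  have hmemmax : ∀ x : ↥(padicCoeffIntegers S), ‖(x : PadicAlgCl p)‖ < 1 → x ∈ IsLocalRing.maximalIdeal ↥(padicCoeffIntegers S) := fun x hx ↦ by
    refine (IsLocalRing.mem_maximalIdeal _).mpr fun hu ↦ ?_
    have h1 := SmallImageRttD2Twist.norm_coe_unit S hu.unit
    rw [IsUnit.unit_spec] at h1
    exact absurd h1 hx.ne
  have hcongrχ : ∀ g₁ : absoluteGaloisGroup K, ((χ₀ g₁ : (↥(padicCoeffIntegers S))ˣ) : ↥(padicCoeffIntegers S)) -
      ((θ' g₁ : (↥(padicCoeffIntegers S))ˣ) : ↥(padicCoeffIntegers S)) ∈ IsLocalRing.maximalIdeal ↥(padicCoeffIntegers S) := fun g₁ ↦ by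
    refine hmemmax _ ?_
    rw [AddSubgroupClass.coe_sub]
    exact hχnear g₁
  obtain ⟨g₁, hg₁⟩ := SmallImageRttD2AuxIdeal.exists_isUnit_cyclotomicCharacter_mul_sub_one_of_congr (S := S) θ' χ₀ hcongrχ hgθ'
  obtain ⟨a, ha₀⟩ := SmallImageRttD2AuxIdeal.exists_auxIdeal_isUnit_map_nsub (D := D₀) h𝔣 hθ𝔣 hg₁ (Ideal.zero_mem _)
    (SmallImageRttD2J2.phi0 S) (SmallImageRttD2J2.phi0_C_X_sub_C_zero S) (SmallImageRttD2J2.phi0_C_C S) (SmallImageRttD2J2.phi0_X S)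
    (D₀.nsub_regular hθfin)
  have hu₁ : ((((χ₀ γK⁻¹ * (θ' γK⁻¹)⁻¹ : (↥(padicCoeffIntegers S))ˣ)) : ↥(padicCoeffIntegers S)) - 1) ∈ IsLocalRing.maximalIdeal ↥(padicCoeffIntegers S) :=
    hmemmax _ (by rw [AddSubgroupClass.coe_sub, OneMemClass.coe_one]; exact SmallImageRttD2Twist.norm_twistUnit_sub_one_lt S _ κ₂ χ₀ θ' hker γK⁻¹)
  have hu₂ : ((((χ₀ γ₂ * (θ' γ₂)⁻¹ : (↥(padicCoeffIntegers S))ˣ)) : ↥(padicCoeffIntegers S)) - 1) ∈ IsLocalRing.maximalIdeal ↥(padicCoeffIntegers S) :=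
    hmemmax _ (by rw [AddSubgroupClass.coe_sub, OneMemClass.coe_one]; exact SmallImageRttD2Twist.norm_twistUnit_sub_one_lt S _ κ₂ χ₀ θ' hker γ₂)
  let cc2 : Literature.NumberTheory.ComplexMultiplication.EllipticUnits.IwasawaAlgebraO₂ S →+* ↥(padicCoeffIntegers S) :=
    (PowerSeries.constantCoeff : PowerSeries ↥(padicCoeffIntegers S) →+* ↥(padicCoeffIntegers S)).comp
      (PowerSeries.constantCoeff : Literature.NumberTheory.ComplexMultiplication.EllipticUnits.IwasawaAlgebraO₂ S →+* PowerSeries ↥(padicCoeffIntegers S))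
  have hcc2X : cc2 PowerSeries.X = 0 := by
    change PowerSeries.constantCoeff (PowerSeries.constantCoeff (PowerSeries.X : Literature.NumberTheory.ComplexMultiplication.EllipticUnits.IwasawaAlgebraO₂ S)) = 0
    rw [PowerSeries.constantCoeff_X, map_zero]
  have hcc2CX : cc2 (PowerSeries.C (PowerSeries.X : PowerSeries ↥(padicCoeffIntegers S))) = 0 := by
    change PowerSeries.constantCoeff (PowerSeries.constantCoeff (PowerSeries.C (PowerSeries.X : PowerSeries ↥(padicCoeffIntegers S)) :
      Literature.NumberTheory.ComplexMultiplication.EllipticUnits.IwasawaAlgebraO₂ S)) = 0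
    rw [PowerSeries.constantCoeff_C, PowerSeries.constantCoeff_X]
  have hcc2CC : ∀ c : ↥(padicCoeffIntegers S), cc2 (PowerSeries.C (PowerSeries.C c : PowerSeries ↥(padicCoeffIntegers S))) = c := fun c ↦ by
    change PowerSeries.constantCoeff (PowerSeries.constantCoeff (PowerSeries.C (PowerSeries.C c : PowerSeries ↥(padicCoeffIntegers S)) :
      Literature.NumberTheory.ComplexMultiplication.EllipticUnits.IwasawaAlgebraO₂ S)) = c
    rw [PowerSeries.constantCoeff_C, PowerSeries.constantCoeff_C]
  have hσX𝔪 : cc2 (σ PowerSeries.X) ∈ IsLocalRing.maximalIdeal ↥(padicCoeffIntegers S) := by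
    rw [hσX, map_sub, map_mul, map_add, map_one, hcc2X, add_zero, mul_one, hcc2CC]
    exact hu₁
  have hσCX𝔪 : cc2 (σ (PowerSeries.C (PowerSeries.X : PowerSeries ↥(padicCoeffIntegers S)))) ∈ IsLocalRing.maximalIdeal ↥(padicCoeffIntegers S) := by
    rw [hσCX, map_sub, map_mul, map_add, map_one, hcc2CX, add_zero, mul_one, hcc2CC]
    exact hu₂
  have hdecomp : ∀ y : Literature.NumberTheory.ComplexMultiplication.EllipticUnits.IwasawaAlgebraO₂ S,
      ∃ (c : ↥(padicCoeffIntegers S)) (G : Literature.NumberTheory.ComplexMultiplication.EllipticUnits.IwasawaAlgebraO₂ S) (H : PowerSeries ↥(padicCoeffIntegers S)),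
        y = PowerSeries.C (PowerSeries.C c) + G * PowerSeries.X + PowerSeries.C (H * PowerSeries.X) := fun y ↦ by
    refine ⟨PowerSeries.constantCoeff (PowerSeries.constantCoeff y), PowerSeries.mk fun n ↦ PowerSeries.coeff (n + 1) y,
      PowerSeries.mk fun n ↦ PowerSeries.coeff (n + 1) (PowerSeries.constantCoeff y), ?_⟩
    have h1 := PowerSeries.eq_shift_mul_X_add_const y
    have h2 := PowerSeries.eq_shift_mul_X_add_const (PowerSeries.constantCoeff y)
    conv_lhs => rw [h1]
    conv_lhs => rw [h2]  -- rewrites inside `C (constantCoeff y)`? if not, fix below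
    rw [map_add, map_mul]
    ring
  have hψ : ∀ y : Literature.NumberTheory.ComplexMultiplication.EllipticUnits.IwasawaAlgebraO₂ S,
      (cc2.comp σ.toRingHom) y - cc2 y ∈ IsLocalRing.maximalIdeal ↥(padicCoeffIntegers S) := fun y ↦ by
    obtain ⟨c, G, H, hy⟩ := hdecomp y
    have hA : cc2 y = c := by
      rw [hy]; simp only [map_add, map_mul, hcc2CC, hcc2X, hcc2CX, mul_zero, add_zero]
    have hB : cc2 (σ y) = c + cc2 (σ G) * cc2 (σ PowerSeries.X) +
        cc2 (σ (PowerSeries.C H)) * cc2 (σ (PowerSeries.C (PowerSeries.X : PowerSeries ↥(padicCoeffIntegers S)))) := by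
      rw [hy]; simp only [map_add, map_mul, hσC, hcc2CC]
    have hval : (cc2.comp σ.toRingHom) y - cc2 y = cc2 (σ G) * cc2 (σ PowerSeries.X) +
        cc2 (σ (PowerSeries.C H)) * cc2 (σ (PowerSeries.C (PowerSeries.X : PowerSeries ↥(padicCoeffIntegers S)))) := by
      rw [RingHom.comp_apply, RingEquiv.toRingHom_eq_coe, RingHom.coe_coe, hB, hA]; ring
    rw [hval]
    exact Ideal.add_mem _ (Ideal.mul_mem_left _ _ hσX𝔪) (Ideal.mul_mem_left _ _ hσCX𝔪)
  have hiff := SmallImageRttD2LamSpec.isUnit_iff_of_sub_mem_maximalIdeal (cc2.comp σ.toRingHom) cc2 hψ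
    ((D₀.toZetaSkeleton (D₀.nsub_regular hθfin)).nsub a)
  have hccmap : ∀ y : Literature.NumberTheory.ComplexMultiplication.EllipticUnits.IwasawaAlgebraO₂ S,
      PowerSeries.constantCoeff (SmallImageRttD2J2.phi0 S y) = cc2 y := fun y ↦ by
    change PowerSeries.constantCoeff (PowerSeries.map _ y) = PowerSeries.constantCoeff (PowerSeries.constantCoeff y)
    rw [← PowerSeries.coeff_zero_eq_constantCoeff_apply (PowerSeries.map _ y), PowerSeries.coeff_map, PowerSeries.coeff_zero_eq_constantCoeff_apply]
  have ha : IsUnit (SmallImageRttD2J2.phi0 S (Dθ.nsub a)) := by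
    rw [hnsub, PowerSeries.isUnit_iff_constantCoeff, hccmap]
    have h0 := PowerSeries.isUnit_iff_constantCoeff.mp ha₀
    rw [hccmap] at h0
    exact hiff.mpr h0
  exact ⟨κ₂, γ₂, 𝔣, χ₀, θ', D₀, D₀', D₁', D₂', hθfin, hker, hN, σ, Dθ, a, ⟨hγ₂ker, ⟨u₁, u₂, hpair⟩, hθ'θ, hfin1, hfin2, h52, he₁, haZ, he₂, he₀, hnsub,
    hσX, hσCX, hσC, SmallImageRttD2TF.torsionBy_C_X_eq_bot S (κ.restrictOfFinrankEqTwo hp K hK2) κ₂ θ' 𝔣 D₁' ⟨u₁, u₂, hpair⟩, ha⟩, ⟨hR, hU⟩,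
    hθ𝔣, ⟨𝔣₀ * (cK • 𝔣₀) * (𝔪 * (cK • 𝔪)), by rw [h𝔣def, pow_one, mul_comm]⟩, h𝔪𝔣,
    by rw [h𝔣def]; exact SmallImageRttD2FrameSymm.smul_symmLevel hcc (SmallImageRttD2FrameSymm.smul_span_natCast cK p) 1⟩

end Summit.BirchSwinnertonDyer.BirchSwinnertonDyer.Theorems.SmallImageRttCharRoadFrame₇

end
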